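import Mathlib.Analysis.Fourier.Convolution
import Mathlib.Analysis.Calculus.BumpFunction.Normed
import Mathlib.Analysis.Calculus.BumpFunction.InnerProduct
import Literature.NumberTheory.LFunctions.RudnickSarnakPairSmoothed
import HarnessLib

/-!
# Pairs of zeros of `ζ` at scale `1/log T`: the Fejér-kernel corollary of Montgomery's theorem

Proofs only (no definitions, no named facts). Third instalment towards the named fact
`Literature.NumberTheory.LFunctions.rudnick_sarnak_unrestricted` (Rudnick–Sarnak, Duke Math. J.
**81** (1996), Theorem 3.2 for `m = 1`) at level `n = 2`. To pass from Montgomery's weighted,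
`L γ/2π`-normalised pair sums (`RudnickSarnakPairSmoothed.lean`) to Rudnick–Sarnak's
unweighted sums in the normalisation `γ̃ = γ log γ/2π` one needs to know that, on average over
zeros `γ ≤ T`, a window of length `≍ 1/log T` at distance `≲ 1` from `γ` contains `O(1)` zeros.
This is the Fejér-kernel corollary of Montgomery's theorem (Goldston 2005, §5, (5.4)–(5.5)), proved here in
counting form from the tree's `montgomery_pair_correlation_restricted_holds`:

* `RudnickSarnak.exists_posDef_testPair` — a continuous `ψ` supported in `[−1/2, 1/2]` with
  `ψ̂ = 𝓕 ψ ≥ 0` real and `≥ c > 0` near `0` (`ψ = φ ⋆ φ` for an even bump `φ`, Mathlib's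
  `Real.fourier_mul_convolution_eq`);
* `RudnickSarnak.exists_pairCount_window_le` — under RH,
  `#{(γ, γ') ∈ (0, T]² : |L(γ − γ')/2π − s| ≤ y₀} ≤ C T log T` uniformly in `|s| + y₀ ≤ L/π`;
* `RudnickSarnak.eventually_card_filter_zetaOrdinate_window_le`,
  `RudnickSarnak.card_filter_scaled_window_le` — unit windows (in `γ` and in `L γ/2π`) contain
  `≤ C₁ log T` zeros below `T` (Riemann–von Mangoldt, Titchmarsh Thm. 9.2);
* `RudnickSarnak.card_fiber_le`, `RudnickSarnak.card_filter_abs_le_le`,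
  `RudnickSarnak.sum_filter_mid_le` — abstract consequences of a window bound: fibres
  `⌊|y_p|/y₀⌋ = m`, the count of `|y_p| ≤ Y`, and `∑_{Y < |y_p| ≤ B} (1 + |y_p|)^{-2}`.

## References

* H. L. Montgomery, Proc. Sympos. Pure Math. 24 (1973), 181–193: Theorem.
* D. A. Goldston, *Notes on pair correlation of zeros and prime numbers*, LMS LNS 322 (2005),
  §5, (5.3)–(5.5) (sums over differences of zeros; the Fejér pair).
* Z. Rudnick, P. Sarnak, Duke Math. J. 81 (1996): (3.71)–(3.77).
* E. C. Titchmarsh, *The Theory of the Riemann Zeta-Function* (1986), Thms. 9.2, 9.4.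
-/

noncomputable section

open Filter MeasureTheory Complex Finset Set
open scoped Real Topology FourierTransform Convolution ComplexConjugate

namespace Literature.NumberTheory.LFunctions

namespace RudnickSarnak

/-! ## A positive-definite test pair and the pair count at scale `1/log T` -/

/-- Modulation shifts the Fourier transform: `𝓕(ψ · e(s ·))(y) = ψ̂(y − s)`. [folklore] -/
theorem fourier_mul_cexp (ψ : ℝ → ℂ) (s y : ℝ) :
    𝓕 (fun a : ℝ ↦ ψ a * cexp (2 * π * I * s * a)) y = 𝓕 ψ (y - s) := by
  rw [Real.fourier_real_eq_integral_exp_smul, Real.fourier_real_eq_integral_exp_smul]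
  refine integral_congr_ae (Eventually.of_forall fun v ↦ ?_)
  simp only [smul_eq_mul]
  rw [mul_comm (ψ v), ← mul_assoc, ← Complex.exp_add]
  congr 2
  push_cast
  ring

/-- The Fourier transform of a real, even, integrable function is real. [folklore] -/
theorem im_fourier_eq_zero_of_even {φ : ℝ → ℝ} (heven : ∀ a, φ (-a) = φ a) (y : ℝ) :
    (𝓕 (fun a : ℝ ↦ (φ a : ℂ)) y).im = 0 := by
  rw [← Complex.conj_eq_iff_im, Real.fourier_real_eq_integral_exp_smul, ← integral_conj]
  rw [← integral_neg_eq_self]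
  refine integral_congr_ae (Eventually.of_forall fun v ↦ ?_)
  simp only [smul_eq_mul, map_mul, Complex.conj_ofReal, heven]
  congr 1
  rw [← Complex.exp_conj]
  congr 1
  simp only [map_mul, Complex.conj_ofReal, Complex.conj_I]
  push_cast
  ring

/-- **A positive-definite test pair.** There is a continuous `ψ : ℝ → ℂ` vanishing on
`|α| > 1/2` whose Fourier transform `ψ̂ = 𝓕 ψ` is real, non-negative, and bounded below by a
positive constant near `0`: take `ψ = φ ⋆ φ` for a smooth even bump `φ ≥ 0` supported in
`[−1/4, 1/4]`, so that `ψ̂ = φ̂²` with `φ̂` real and `φ̂(0) = ∫ φ > 0` (the Fejér-kernel device of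
Goldston 2005, §5, (5.4)). [cite: Goldston2005, §5 (5.4)] -/
theorem exists_posDef_testPair :
    ∃ ψ : ℝ → ℂ, Continuous ψ ∧ (∀ α, 1 / 2 < |α| → ψ α = 0) ∧
      (∀ y, (𝓕 ψ y).im = 0) ∧ (∀ y, 0 ≤ (𝓕 ψ y).re) ∧
      ∃ y₀ > 0, ∃ c > 0, ∀ y, |y| ≤ y₀ → c ≤ (𝓕 ψ y).re := by
  -- the bump
  let b : ContDiffBump (0 : ℝ) := ⟨1 / 8, 1 / 4, by norm_num, by norm_num⟩
  set φ : ℝ → ℂ := fun a ↦ (b a : ℂ) with hφ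
  have hφc : Continuous φ := continuous_ofReal.comp b.continuous
  have hφs : HasCompactSupport φ := b.hasCompactSupport.comp_left Complex.ofReal_zero
  have hφi : Integrable φ := hφc.integrable_of_hasCompactSupport hφs
  have hφsupp : Function.support φ ⊆ Metric.ball 0 (1 / 4) := by
    intro a ha
    have : b a ≠ 0 := fun h ↦ ha (by simp [hφ, h])
    have h2 := b.support_eq ▸ (Function.mem_support.2 this)
    have hr : b.rOut = 1 / 4 := rfl
    rw [hr] at h2
    simpa using h2
  -- the autocorrelation
  set ψ : ℝ → ℂ := φ ⋆[ContinuousLinearMap.mul ℂ ℂ] φ with hψ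
  have hψc : Continuous ψ := hφs.continuous_convolution_right _ hφi.locallyIntegrable hφc
  have hψ0 : ∀ α : ℝ, 1 / 2 < |α| → ψ α = 0 := by
    intro α hα
    by_contra hne
    have hmem := support_convolution_subset (ContinuousLinearMap.mul ℂ ℂ) (Function.mem_support.2 hne)
    obtain ⟨x, hx, z, hz, hxz⟩ := Set.mem_add.1 hmem
    have hx' := hφsupp hx
    have hz' := hφsupp hz
    rw [Metric.mem_ball, dist_zero_right, Real.norm_eq_abs] at hx' hz'
    have : |α| < 1 / 2 := by
      rw [← hxz]
      calc |x + z| ≤ |x| + |z| := abs_add_le x z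
        _ < 1 / 4 + 1 / 4 := add_lt_add hx' hz'
        _ = 1 / 2 := by norm_num
    linarith
  -- Fourier side
  have hF : ∀ y, 𝓕 ψ y = 𝓕 φ y * 𝓕 φ y := fun y ↦ Real.fourier_mul_convolution_eq hφi hφi y
  have him : ∀ y, (𝓕 φ y).im = 0 := im_fourier_eq_zero_of_even (fun a ↦ b.neg a)
  have hre2 : ∀ y, (𝓕 ψ y).re = (𝓕 φ y).re ^ 2 := by
    intro y
    rw [hF, Complex.mul_re, him]
    ring
  have him2 : ∀ y, (𝓕 ψ y).im = 0 := by
    intro y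
    rw [hF, Complex.mul_im, him]
    ring
  -- positivity at `0` and continuity
  have hcont : Continuous (𝓕 φ) :=
    VectorFourier.fourierIntegral_continuous Real.continuous_fourierChar
      (innerSL ℝ).continuous₂ hφi
  have h0 : (𝓕 φ 0).re = ∫ a, b a := by
    rw [Real.fourier_real_eq_integral_exp_smul]
    simp only [mul_zero, Complex.ofReal_zero, zero_mul, Complex.exp_zero, one_smul]
    rw [hφ, integral_complex_ofReal, Complex.ofReal_re]
  have hpos : 0 < (𝓕 φ 0).re := by
    rw [h0]
    exact b.integral_pos
  obtain ⟨y₀, hy₀, hnear⟩ : ∃ y₀ > 0, ∀ y : ℝ, |y| ≤ y₀ → (𝓕 φ 0).re / 2 ≤ (𝓕 φ y).re := by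
    have hc : Continuous fun y ↦ (𝓕 φ y).re := Complex.continuous_re.comp hcont
    have hev : ∀ᶠ y in 𝓝 (0 : ℝ), (𝓕 φ 0).re / 2 < (𝓕 φ y).re :=
      hc.continuousAt.eventually (lt_mem_nhds (by linarith))
    obtain ⟨ε, hε, hball⟩ := Metric.eventually_nhds_iff.1 hev
    refine ⟨ε / 2, by positivity, fun y hy ↦ (hball ?_).le⟩
    rw [dist_zero_right, Real.norm_eq_abs]
    linarith
  refine ⟨ψ, hψc, hψ0, him2, fun y ↦ by rw [hre2]; positivity, y₀, hy₀, ((𝓕 φ 0).re / 2) ^ 2,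
    by positivity, fun y hy ↦ ?_⟩
  rw [hre2]
  have h1 := hnear y hy
  have h2 : 0 ≤ (𝓕 φ 0).re / 2 := by positivity
  nlinarith

/-- Montgomery's weight is at least `1/2` on `|u| ≤ 2`. [cite: Montgomery1973, §1 (1)] -/
theorem half_le_montgomeryWeight {u : ℝ} (hu : |u| ≤ 2) : 1 / 2 ≤ montgomeryWeight u := by
  rw [montgomeryWeight, le_div_iff₀ (by positivity)]
  have : u ^ 2 ≤ 4 := by nlinarith [abs_nonneg u, sq_abs u]
  linarith

/-- **Pairs of zeros at scale `1/log T`** (the Fejér-kernel corollary of Montgomery's Theorem,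
Goldston 2005, §5, (5.4)–(5.5), in counting form): assuming RH there are `y₀ > 0` and `C` such
that for all large `T` and every shift `s` with `|s| + y₀ ≤ log T/π`,
`#{(γ, γ') ∈ (0, T]² : |L(γ − γ')/2π − s| ≤ y₀} ≤ C · T log T` (`L = log T`, zeros with
multiplicity) — on average over zeros, windows of length `≍ 1/log T` at distance `≲ 1` contain
`O(1)` other zeros. Proof: apply `sum_pairs_fourier_eq_integral_formFactor` to the modulated
positive-definite pair `θ = ψ e(s·)` of `exists_posDef_testPair` (`θ̂ = ψ̂(· − s) ≥ 0`,
`≥ c` on the window, where also `w ≥ 1/2`) and bound `∫ F θ` by `norm_integral_formFactor_le`.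
[cite: Goldston2005, §5 (5.4)–(5.5)] -/
theorem exists_pairCount_window_le (hRH : RiemannHypothesis) :
    ∃ y₀ > 0, ∃ C : ℝ, ∀ᶠ T : ℝ in atTop, ∀ s : ℝ, |s| + y₀ ≤ Real.log T / π →
      (((zeroIndexSet T ×ˢ zeroIndexSet T).filter fun p ↦
          |Real.log T / (2 * π) * (zetaOrdinate p.1 - zetaOrdinate p.2) - s| ≤ y₀).card : ℝ) ≤
        C * (T * Real.log T) := by
  obtain ⟨ψ, hψc, hψ0, him, hre, y₀, hy₀, c, hc, hnear⟩ := exists_posDef_testPair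
  have hψs : HasCompactSupport ψ := hasCompactSupport_of_eq_zero hψ0
  obtain ⟨B, hB⟩ := hψc.bounded_above_of_compact_support hψs
  have hB0 : 0 ≤ B := (norm_nonneg _).trans (hB 0)
  set B₁ : ℝ := ∫ α, ‖ψ α‖ with hB₁
  have hB₁0 : 0 ≤ B₁ := integral_nonneg fun α ↦ norm_nonneg _
  refine ⟨y₀, hy₀, 2 * (B + B₁) / (π * c), ?_⟩
  filter_upwards [montgomery_pair_correlation_restricted_holds hRH (δ := 1 / 2) (ε := 1)
    (by norm_num) one_pos, eventually_gt_atTop (1 : ℝ)] with T hM hT s hs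
  have hT0 : 0 < T := one_pos.trans hT
  have hL : 0 < Real.log T := Real.log_pos hT
  -- the modulated test function
  set θ : ℝ → ℂ := fun a ↦ ψ a * cexp (2 * π * I * s * a) with hθ
  have hθc : Continuous θ := by
    simp only [hθ]
    fun_prop
  have hθnorm : ∀ a, ‖θ a‖ = ‖ψ a‖ := by
    intro a
    simp only [hθ, norm_mul, Complex.norm_exp]
    have : (2 * π * I * s * a : ℂ).re = 0 := by simp
    rw [this, Real.exp_zero, mul_one]
  have hθ0 : ∀ α, 1 - 1 / 2 < |α| → θ α = 0 := by
    intro α hα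
    simp only [hθ, hψ0 α (by linarith), zero_mul]
  have hθB : ∀ α, ‖θ α‖ ≤ B := fun α ↦ (hθnorm α).le.trans (hB α)
  have hθs : HasCompactSupport θ := hasCompactSupport_of_eq_zero hθ0
  have hθ1 : ∫ α, ‖θ α‖ = B₁ := by simp_rw [hθnorm, hB₁]
  -- Montgomery: `‖∫ F θ‖ ≤ 2 (B + B₁)`
  have hA := norm_integral_formFactor_le hT zero_le_one (by norm_num : (0 : ℝ) ≤ 1 / 2) hM hθc hθ0 hθB
  rw [hθ1] at hA
  -- duality
  have hS1 := sum_pairs_fourier_eq_integral_formFactor θ hθc hθs hT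
  simp_rw [hθ, fourier_mul_cexp] at hS1
  set S : ℂ := ∑ p ∈ zeroIndexSet T ×ˢ zeroIndexSet T,
    (montgomeryWeight (zetaOrdinate p.1 - zetaOrdinate p.2) : ℂ) *
      𝓕 ψ (Real.log T / (2 * π) * (zetaOrdinate p.1 - zetaOrdinate p.2) - s) with hSdef
  have hSnorm : ‖S‖ ≤ T * Real.log T / π * (B + B₁) := by
    rw [hS1, norm_mul, Complex.norm_real, Real.norm_of_nonneg (by positivity)]
    calc T * Real.log T / (2 * π) * ‖∫ α, (montgomeryFormFactor α T : ℂ) * θ α‖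
        ≤ T * Real.log T / (2 * π) * ((1 + 1) * (B + B₁)) :=
          mul_le_mul_of_nonneg_left hA (by positivity)
      _ = T * Real.log T / π * (B + B₁) := by ring
  -- lower bound for `Re S`
  set W := (zeroIndexSet T ×ˢ zeroIndexSet T).filter fun p ↦
    |Real.log T / (2 * π) * (zetaOrdinate p.1 - zetaOrdinate p.2) - s| ≤ y₀ with hW
  have hterm_nonneg : ∀ p ∈ zeroIndexSet T ×ˢ zeroIndexSet T,
      0 ≤ ((montgomeryWeight (zetaOrdinate p.1 - zetaOrdinate p.2) : ℂ) *
        𝓕 ψ (Real.log T / (2 * π) * (zetaOrdinate p.1 - zetaOrdinate p.2) - s)).re := by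
    intro p _
    rw [Complex.re_ofReal_mul]
    exact mul_nonneg (montgomeryWeight_pos _).le (hre _)
  have hterm_ge : ∀ p ∈ W, c / 2 ≤ ((montgomeryWeight (zetaOrdinate p.1 - zetaOrdinate p.2) : ℂ) *
        𝓕 ψ (Real.log T / (2 * π) * (zetaOrdinate p.1 - zetaOrdinate p.2) - s)).re := by
    intro p hp
    rw [hW, Finset.mem_filter] at hp
    rw [Complex.re_ofReal_mul]
    have hy : |Real.log T / (2 * π) * (zetaOrdinate p.1 - zetaOrdinate p.2)| ≤ Real.log T / π := by
      have h1 : |Real.log T / (2 * π) * (zetaOrdinate p.1 - zetaOrdinate p.2)| ≤ |s| + y₀ := by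
        have := abs_sub_abs_le_abs_sub (Real.log T / (2 * π) * (zetaOrdinate p.1 - zetaOrdinate p.2)) s
        linarith [hp.2]
      exact h1.trans hs
    have hu : |zetaOrdinate p.1 - zetaOrdinate p.2| ≤ 2 := by
      rw [abs_mul, abs_of_pos (by positivity)] at hy
      rw [div_mul_eq_mul_div, le_div_iff₀ Real.pi_pos, div_mul_eq_mul_div,
        div_le_iff₀ (by positivity)] at hy
      have hy' : |zetaOrdinate p.1 - zetaOrdinate p.2| * (Real.log T * π) ≤
          2 * (Real.log T * π) := by linarith
      exact le_of_mul_le_mul_right hy' (by positivity)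
    have hw := half_le_montgomeryWeight hu
    have hg := hnear _ hp.2
    calc c / 2 = 1 / 2 * c := by ring
      _ ≤ montgomeryWeight (zetaOrdinate p.1 - zetaOrdinate p.2) *
          (𝓕 ψ (Real.log T / (2 * π) * (zetaOrdinate p.1 - zetaOrdinate p.2) - s)).re :=
        mul_le_mul hw hg hc.le (montgomeryWeight_pos _).le
  have hre_ge : (W.card : ℝ) * (c / 2) ≤ S.re := by
    rw [hSdef, Complex.re_sum]
    calc (W.card : ℝ) * (c / 2) = ∑ p ∈ W, c / 2 := by rw [Finset.sum_const, nsmul_eq_mul]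
      _ ≤ ∑ p ∈ W, ((montgomeryWeight (zetaOrdinate p.1 - zetaOrdinate p.2) : ℂ) *
          𝓕 ψ (Real.log T / (2 * π) * (zetaOrdinate p.1 - zetaOrdinate p.2) - s)).re :=
        Finset.sum_le_sum hterm_ge
      _ ≤ _ := Finset.sum_le_sum_of_subset_of_nonneg (Finset.filter_subset _ _)
          fun p hp _ ↦ hterm_nonneg p hp
  have hfinal : (W.card : ℝ) * (c / 2) ≤ T * Real.log T / π * (B + B₁) :=
    hre_ge.trans ((Complex.re_le_norm S).trans hSnorm)
  calc (W.card : ℝ) = (W.card : ℝ) * (c / 2) / (c / 2) := by field_simp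
    _ ≤ T * Real.log T / π * (B + B₁) / (c / 2) := by gcongr
    _ = 2 * (B + B₁) / (π * c) * (T * Real.log T) := by
        field_simp

/-! ## Local (unit-window) bounds in Montgomery's variable `L γ/2π` and in `γ̃` -/

/-- **Zeros in unit windows, uniformly.** There is `C₁ > 0` such that for all large `T` and
every `a ∈ ℝ`, at most `C₁ log T` indices `c < N(T)` have `γ_c ∈ [a, a + 1]`
(from `N(u + 4) − N(u − 1) ≤ C log T`, `exists_zetaZeroCount_window_le`). [cite: Titchmarsh1986, Thm. 9.2] -/
theorem eventually_card_filter_zetaOrdinate_window_le :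
    ∃ C₁ : ℝ, 0 < C₁ ∧ ∀ᶠ T : ℝ in atTop, ∀ a : ℝ,
      (((Finset.range (zetaZeroCount T)).filter fun c ↦
          a ≤ zetaOrdinate c ∧ zetaOrdinate c ≤ a + 1).card : ℝ) ≤ C₁ * Real.log T := by
  obtain ⟨C, hC, T₁, hwin⟩ := exists_zetaZeroCount_window_le
  refine ⟨C, hC, ?_⟩
  filter_upwards [eventually_ge_atTop T₁, eventually_ge_atTop (1 : ℝ)] with T hT hT1 a
  classical
  have hRvM := riemann_von_mangoldt_holds
  have hlogT : 0 ≤ Real.log T := Real.log_nonneg hT1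
  set W := (Finset.range (zetaZeroCount T)).filter fun c ↦
    a ≤ zetaOrdinate c ∧ zetaOrdinate c ≤ a + 1 with hW
  rcases W.eq_empty_or_nonempty with hW0 | ⟨c₀, hc₀⟩
  · rw [hW0, Finset.card_empty, Nat.cast_zero]
    positivity
  rw [hW, Finset.mem_filter, Finset.mem_range] at hc₀
  have hγ₀T : zetaOrdinate c₀ ≤ T := hRvM.zetaOrdinate_le_iff.2 hc₀.1
  have hγ₀pos : 0 < zetaOrdinate c₀ := zetaOrdinate_pos_holds c₀
  have h14 : 14 < zetaOrdinate c₀ :=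
    fourteen_lt_zetaOrdinate_zero_holds.trans_le (zetaOrdinate_mono_holds (Nat.zero_le c₀))
  -- `W ⊆ [N(γ_{c₀} − 2), N(γ_{c₀} + 3))`, a window `(u − 1, u + 4]` with `u = γ_{c₀} − 1`
  have hsub : W ⊆ Finset.Ico (zetaZeroCount (zetaOrdinate c₀ - 2))
      (zetaZeroCount (zetaOrdinate c₀ + 3)) := by
    intro c hc
    rw [hW, Finset.mem_filter, Finset.mem_range] at hc
    rw [Finset.mem_Ico]
    constructor
    · refine hRvM.zetaZeroCount_le_of_lt_zetaOrdinate ?_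
      linarith [hc.2.1, hc₀.2.2]
    · refine hRvM.zetaOrdinate_le_iff.1 ?_
      linarith [hc.2.2, hc₀.2.1]
  have hcard := Finset.card_le_card hsub
  rw [Nat.card_Ico] at hcard
  have h1 := hwin T hT (zetaOrdinate c₀ - 1) (by linarith) (by linarith)
  have e1 : zetaOrdinate c₀ - 1 + 4 = zetaOrdinate c₀ + 3 := by ring
  have e2 : zetaOrdinate c₀ - 1 - 1 = zetaOrdinate c₀ - 2 := by ring
  rw [e1, e2] at h1
  have hmono : zetaZeroCount (zetaOrdinate c₀ - 2) ≤ zetaZeroCount (zetaOrdinate c₀ + 3) :=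
    zetaZeroCount_mono (by linarith)
  calc (W.card : ℝ)
      ≤ ((zetaZeroCount (zetaOrdinate c₀ + 3) - zetaZeroCount (zetaOrdinate c₀ - 2) : ℕ) : ℝ) := by
        exact_mod_cast hcard
    _ = (zetaZeroCount (zetaOrdinate c₀ + 3) : ℝ) - zetaZeroCount (zetaOrdinate c₀ - 2) := by
        rw [Nat.cast_sub hmono]
    _ ≤ C * Real.log T := h1

/-- Unit windows in Montgomery's variable `L γ_c/2π` (`L = log T ≥ 2π`) are unit-or-shorter
windows in `γ`, so they too contain `≤ C₁ log T` indices `c < N(T)`. [cite: Titchmarsh1986, Thm. 9.2] -/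
theorem card_filter_scaled_window_le {T C₁ : ℝ} (hL : 2 * π ≤ Real.log T)
    (hwin : ∀ a : ℝ, (((Finset.range (zetaZeroCount T)).filter fun c ↦
      a ≤ zetaOrdinate c ∧ zetaOrdinate c ≤ a + 1).card : ℝ) ≤ C₁ * Real.log T) (v : ℝ) :
    (((Finset.range (zetaZeroCount T)).filter fun c ↦
        v ≤ Real.log T / (2 * π) * zetaOrdinate c ∧
          Real.log T / (2 * π) * zetaOrdinate c ≤ v + 1).card : ℝ) ≤ C₁ * Real.log T := by
  have hLpos : 0 < Real.log T := by linarith [Real.pi_pos]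
  have hc : 0 < Real.log T / (2 * π) := by positivity
  refine le_trans ?_ (hwin (2 * π * v / Real.log T))
  have hsub : ((Finset.range (zetaZeroCount T)).filter fun c ↦
      v ≤ Real.log T / (2 * π) * zetaOrdinate c ∧
        Real.log T / (2 * π) * zetaOrdinate c ≤ v + 1) ⊆
      ((Finset.range (zetaZeroCount T)).filter fun c ↦
        2 * π * v / Real.log T ≤ zetaOrdinate c ∧ zetaOrdinate c ≤ 2 * π * v / Real.log T + 1) := by
    intro c hc
    rw [Finset.mem_filter] at hc ⊢
    obtain ⟨hc0, h1, h2⟩ := hc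
    refine ⟨hc0, ?_, ?_⟩
    · rw [div_le_iff₀ hLpos]
      rw [div_mul_eq_mul_div, le_div_iff₀ (by positivity)] at h1
      linarith
    · have h2' : zetaOrdinate c * Real.log T ≤ 2 * π * (v + 1) := by
        rw [div_mul_eq_mul_div, div_le_iff₀ (by positivity : (0 : ℝ) < 2 * π)] at h2
        linarith
      rw [show 2 * π * v / Real.log T + 1 = (2 * π * v + Real.log T) / Real.log T by
        field_simp]
      rw [le_div_iff₀ hLpos]
      linarith
  exact_mod_cast Finset.card_le_card hsub

/-- `∑_{m ∈ [a, b)} 1/m² ≤ 1/(a − 1)` for `2 ≤ a` (telescoping `1/m² ≤ 1/(m−1) − 1/m`). [folklore] -/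
theorem sum_Ico_inv_sq_le {a : ℕ} (ha : 2 ≤ a) (b : ℕ) :
    ∑ m ∈ Finset.Ico a b, ((m : ℝ) ^ 2)⁻¹ ≤ ((a : ℝ) - 1)⁻¹ := by
  have key : ∀ b, a ≤ b → ∑ m ∈ Finset.Ico a b, ((m : ℝ) ^ 2)⁻¹ ≤ ((a : ℝ) - 1)⁻¹ - ((b : ℝ) - 1)⁻¹ := by
    intro b hb
    induction b, hb using Nat.le_induction with
    | base => simp
    | succ n hn ih =>
      rw [Finset.sum_Ico_succ_top hn]
      have hn2 : (2 : ℝ) ≤ n := by exact_mod_cast ha.trans hn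
      have h1 : ((n : ℝ) ^ 2)⁻¹ ≤ ((n : ℝ) - 1)⁻¹ - ((n : ℝ))⁻¹ := by
        rw [inv_sub_inv (by linarith) (by linarith),
          show ((n : ℝ) - ((n : ℝ) - 1)) = 1 by ring, one_div]
        exact inv_anti₀ (by nlinarith) (by nlinarith)
      push_cast
      rw [show ((n : ℝ) + 1 - 1) = n by ring]
      linarith
  rcases le_or_gt a b with hab | hab
  · have h := key b hab
    have : 0 ≤ ((b : ℝ) - 1)⁻¹ := by
      have : (2 : ℝ) ≤ b := by exact_mod_cast ha.trans hab
      exact inv_nonneg.2 (by linarith)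
    linarith
  · rw [Finset.Ico_eq_empty_of_le hab.le, Finset.sum_empty]
    have : (2 : ℝ) ≤ a := by exact_mod_cast ha
    exact inv_nonneg.2 (by linarith)

/-- **Fibres of the windows.** If every window `{p : |y_p − s| ≤ y₀}` with `|s| + y₀ ≤ R`
has at most `M` elements, then the fibre `{p : ⌊|y_p|/y₀⌋ = m}` has at most `2M` elements
whenever `(m + 3/2) y₀ ≤ R` (it lies in the two windows centred at `±(m + 1/2) y₀`). [folklore] -/
theorem card_fiber_le {ι : Type*} (P : Finset ι) (y : ι → ℝ) {y₀ R M : ℝ} (hy₀ : 0 < y₀)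
    (hwin : ∀ s : ℝ, |s| + y₀ ≤ R → ((P.filter fun p ↦ |y p - s| ≤ y₀).card : ℝ) ≤ M)
    {m : ℕ} (hm : ((m : ℝ) + 3 / 2) * y₀ ≤ R) :
    ((P.filter fun p ↦ ⌊|y p| / y₀⌋₊ = m).card : ℝ) ≤ 2 * M := by
  classical
  set s₀ : ℝ := ((m : ℝ) + 1 / 2) * y₀ with hs₀
  have hs₀abs : |s₀| + y₀ ≤ R ∧ |-s₀| + y₀ ≤ R := by
    have : |s₀| = s₀ := abs_of_nonneg (by positivity)
    rw [abs_neg, this]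
    constructor <;> nlinarith
  have hsub : (P.filter fun p ↦ ⌊|y p| / y₀⌋₊ = m) ⊆
      (P.filter fun p ↦ |y p - s₀| ≤ y₀) ∪ (P.filter fun p ↦ |y p - (-s₀)| ≤ y₀) := by
    intro p hp
    rw [Finset.mem_filter] at hp
    rw [Finset.mem_union, Finset.mem_filter, Finset.mem_filter]
    have hfl := hp.2
    have h0 : 0 ≤ |y p| / y₀ := by positivity
    have h1 : (m : ℝ) ≤ |y p| / y₀ := by
      have := Nat.floor_le h0
      rw [hfl] at this
      exact this
    have h2 : |y p| / y₀ < m + 1 := by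
      have := Nat.lt_floor_add_one (|y p| / y₀)
      rw [hfl] at this
      exact_mod_cast this
    rw [le_div_iff₀ hy₀] at h1
    rw [div_lt_iff₀ hy₀] at h2
    rcases le_or_gt 0 (y p) with hyp | hyp
    · left
      refine ⟨hp.1, ?_⟩
      rw [abs_of_nonneg hyp] at h1 h2
      rw [abs_le]
      constructor <;> nlinarith
    · right
      refine ⟨hp.1, ?_⟩
      rw [abs_of_neg hyp] at h1 h2
      rw [sub_neg_eq_add, abs_le]
      constructor <;> nlinarith
  calc ((P.filter fun p ↦ ⌊|y p| / y₀⌋₊ = m).card : ℝ)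
      ≤ (((P.filter fun p ↦ |y p - s₀| ≤ y₀) ∪ (P.filter fun p ↦ |y p - (-s₀)| ≤ y₀)).card : ℝ) := by
        exact_mod_cast Finset.card_le_card hsub
    _ ≤ ((P.filter fun p ↦ |y p - s₀| ≤ y₀).card : ℝ) +
        ((P.filter fun p ↦ |y p - (-s₀)| ≤ y₀).card : ℝ) := by
        exact_mod_cast Finset.card_union_le _ _
    _ ≤ M + M := add_le_add (hwin _ hs₀abs.1) (hwin _ hs₀abs.2)
    _ = 2 * M := by ring

/-- **Counting near pairs.** Under the window hypothesis, `#{p : |y_p| ≤ Y} ≤ 2M(⌊Y/y₀⌋ + 1)`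
whenever `(Y/y₀ + 5/2) y₀ ≤ R`. [folklore] -/
theorem card_filter_abs_le_le {ι : Type*} (P : Finset ι) (y : ι → ℝ) {y₀ R M Y : ℝ} (hy₀ : 0 < y₀)
    (hY : 0 ≤ Y)
    (hwin : ∀ s : ℝ, |s| + y₀ ≤ R → ((P.filter fun p ↦ |y p - s| ≤ y₀).card : ℝ) ≤ M)
    (hR : (Y / y₀ + 5 / 2) * y₀ ≤ R) :
    ((P.filter fun p ↦ |y p| ≤ Y).card : ℝ) ≤ 2 * M * (⌊Y / y₀⌋₊ + 1) := by
  classical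
  set S := P.filter fun p ↦ |y p| ≤ Y with hS
  have hmaps : ∀ p ∈ S, ⌊|y p| / y₀⌋₊ ∈ Finset.range (⌊Y / y₀⌋₊ + 1) := by
    intro p hp
    rw [hS, Finset.mem_filter] at hp
    rw [Finset.mem_range, Nat.lt_add_one_iff]
    exact Nat.floor_le_floor (div_le_div_of_nonneg_right hp.2 hy₀.le)
  have hcard := Finset.card_eq_sum_card_fiberwise hmaps
  have hfib : ∀ m ∈ Finset.range (⌊Y / y₀⌋₊ + 1),
      ((S.filter fun p ↦ ⌊|y p| / y₀⌋₊ = m).card : ℝ) ≤ 2 * M := by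
    intro m hm
    rw [Finset.mem_range, Nat.lt_add_one_iff] at hm
    have hm' : ((m : ℝ) + 3 / 2) * y₀ ≤ R := by
      have h1 : (m : ℝ) ≤ ⌊Y / y₀⌋₊ := by exact_mod_cast hm
      have h2 : (⌊Y / y₀⌋₊ : ℝ) ≤ Y / y₀ := Nat.floor_le (by positivity)
      nlinarith
    calc ((S.filter fun p ↦ ⌊|y p| / y₀⌋₊ = m).card : ℝ)
        ≤ ((P.filter fun p ↦ ⌊|y p| / y₀⌋₊ = m).card : ℝ) := by
          exact_mod_cast Finset.card_le_card
            (Finset.filter_subset_filter _ (Finset.filter_subset _ _))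
      _ ≤ 2 * M := card_fiber_le P y hy₀ hwin hm'
  calc (S.card : ℝ) = ∑ m ∈ Finset.range (⌊Y / y₀⌋₊ + 1),
        ((S.filter fun p ↦ ⌊|y p| / y₀⌋₊ = m).card : ℝ) := by
        rw [hcard]
        push_cast
        rfl
    _ ≤ ∑ m ∈ Finset.range (⌊Y / y₀⌋₊ + 1), 2 * M := Finset.sum_le_sum hfib
    _ = 2 * M * (⌊Y / y₀⌋₊ + 1) := by
        rw [Finset.sum_const, Finset.card_range, nsmul_eq_mul]
        push_cast
        ring

/-- **The middle range.** Under the window hypothesis, for `3y₀ ≤ Y` and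
`(B/y₀ + 5/2) y₀ ≤ R`:
`∑_{p : Y < |y_p| ≤ B} (1 + |y_p|)^{-2} ≤ 2M / (y₀ (Y − 2y₀))`
(fibres `m ≥ ⌊Y/y₀⌋ ≥ 2`, on which `(1 + |y_p|)^{-2} ≤ (m y₀)^{-2}`, and
`∑_{m ≥ a} m^{-2} ≤ 1/(a − 1)`). [folklore] -/
theorem sum_filter_mid_le {ι : Type*} (P : Finset ι) (y : ι → ℝ) {y₀ R M Y B : ℝ} (hy₀ : 0 < y₀)
    (hY : 3 * y₀ ≤ Y) (hM : 0 ≤ M)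
    (hwin : ∀ s : ℝ, |s| + y₀ ≤ R → ((P.filter fun p ↦ |y p - s| ≤ y₀).card : ℝ) ≤ M)
    (hR : (B / y₀ + 5 / 2) * y₀ ≤ R) :
    ∑ p ∈ P with Y < |y p| ∧ |y p| ≤ B, ((1 + |y p|) ^ 2)⁻¹ ≤ 2 * M / (y₀ * (Y - 2 * y₀)) := by
  classical
  set S := P.filter fun p ↦ Y < |y p| ∧ |y p| ≤ B with hS
  set a := ⌊Y / y₀⌋₊ with ha
  set b := ⌊B / y₀⌋₊ + 1 with hb
  have hY0 : 0 < Y := by linarith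
  have ha2 : 2 ≤ a := by
    rw [ha, Nat.le_floor_iff (by positivity)]
    rw [le_div_iff₀ hy₀]
    push_cast
    linarith
  have hmaps : ∀ p ∈ S, ⌊|y p| / y₀⌋₊ ∈ Finset.Ico a b := by
    intro p hp
    rw [hS, Finset.mem_filter] at hp
    rw [Finset.mem_Ico]
    constructor
    · exact Nat.floor_le_floor (div_le_div_of_nonneg_right hp.2.1.le hy₀.le)
    · rw [hb, Nat.lt_add_one_iff]
      exact Nat.floor_le_floor (div_le_div_of_nonneg_right hp.2.2 hy₀.le)
  rw [← Finset.sum_fiberwise_of_maps_to hmaps]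
  have hfib : ∀ m ∈ Finset.Ico a b,
      ∑ p ∈ S with ⌊|y p| / y₀⌋₊ = m, ((1 + |y p|) ^ 2)⁻¹ ≤ 2 * M * (y₀ ^ 2)⁻¹ * ((m : ℝ) ^ 2)⁻¹ := by
    intro m hm
    rw [Finset.mem_Ico] at hm
    have hm1 : (1 : ℝ) ≤ m := by exact_mod_cast (le_trans (by norm_num) ha2).trans hm.1
    have hterm : ∀ p ∈ S.filter (fun p ↦ ⌊|y p| / y₀⌋₊ = m),
        ((1 + |y p|) ^ 2)⁻¹ ≤ (y₀ ^ 2)⁻¹ * ((m : ℝ) ^ 2)⁻¹ := by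
      intro p hp
      rw [Finset.mem_filter] at hp
      have h1 : (m : ℝ) ≤ |y p| / y₀ := by
        have := Nat.floor_le (show 0 ≤ |y p| / y₀ by positivity)
        rw [hp.2] at this
        exact this
      rw [le_div_iff₀ hy₀] at h1
      rw [← mul_inv, inv_le_inv₀ (by positivity) (by positivity)]
      have : 0 ≤ (m : ℝ) * y₀ := by positivity
      nlinarith [abs_nonneg (y p)]
    have hcardm : ((S.filter fun p ↦ ⌊|y p| / y₀⌋₊ = m).card : ℝ) ≤ 2 * M := by
      have hm' : ((m : ℝ) + 3 / 2) * y₀ ≤ R := by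
        have h1 : (m : ℝ) ≤ ⌊B / y₀⌋₊ := by
          have : m ≤ ⌊B / y₀⌋₊ := Nat.lt_add_one_iff.1 (hb ▸ hm.2)
          exact_mod_cast this
        have h2 : (⌊B / y₀⌋₊ : ℝ) ≤ B / y₀ := Nat.floor_le (by
          have : 0 ≤ B := by
            by_contra hB
            push Not at hB
            have : (⌊B / y₀⌋₊ : ℝ) = 0 := by
              rw [Nat.floor_of_nonpos (div_nonpos_of_nonpos_of_nonneg hB.le hy₀.le)]
              simp
            have hm0 : (m : ℝ) ≤ 0 := by linarith
            linarith
          positivity)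
        nlinarith
      calc ((S.filter fun p ↦ ⌊|y p| / y₀⌋₊ = m).card : ℝ)
          ≤ ((P.filter fun p ↦ ⌊|y p| / y₀⌋₊ = m).card : ℝ) := by
            exact_mod_cast Finset.card_le_card
              (Finset.filter_subset_filter _ (Finset.filter_subset _ _))
        _ ≤ 2 * M := card_fiber_le P y hy₀ hwin hm'
    calc ∑ p ∈ S with ⌊|y p| / y₀⌋₊ = m, ((1 + |y p|) ^ 2)⁻¹
        ≤ ∑ p ∈ S with ⌊|y p| / y₀⌋₊ = m, (y₀ ^ 2)⁻¹ * ((m : ℝ) ^ 2)⁻¹ := Finset.sum_le_sum hterm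
      _ = ((S.filter fun p ↦ ⌊|y p| / y₀⌋₊ = m).card : ℝ) * ((y₀ ^ 2)⁻¹ * ((m : ℝ) ^ 2)⁻¹) := by
          rw [Finset.sum_const, nsmul_eq_mul]
      _ ≤ 2 * M * ((y₀ ^ 2)⁻¹ * ((m : ℝ) ^ 2)⁻¹) :=
          mul_le_mul_of_nonneg_right hcardm (by positivity)
      _ = 2 * M * (y₀ ^ 2)⁻¹ * ((m : ℝ) ^ 2)⁻¹ := by ring
  calc ∑ m ∈ Finset.Ico a b, ∑ p ∈ S with ⌊|y p| / y₀⌋₊ = m, ((1 + |y p|) ^ 2)⁻¹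
      ≤ ∑ m ∈ Finset.Ico a b, 2 * M * (y₀ ^ 2)⁻¹ * ((m : ℝ) ^ 2)⁻¹ := Finset.sum_le_sum hfib
    _ = 2 * M * (y₀ ^ 2)⁻¹ * ∑ m ∈ Finset.Ico a b, ((m : ℝ) ^ 2)⁻¹ := by rw [Finset.mul_sum]
    _ ≤ 2 * M * (y₀ ^ 2)⁻¹ * ((a : ℝ) - 1)⁻¹ :=
        mul_le_mul_of_nonneg_left (sum_Ico_inv_sq_le ha2 b) (by positivity)
    _ ≤ 2 * M * (y₀ ^ 2)⁻¹ * ((Y - 2 * y₀) / y₀)⁻¹ := by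
        have hYy : 0 < (Y - 2 * y₀) / y₀ := by
          apply div_pos _ hy₀
          linarith
        have ha1 : (Y - 2 * y₀) / y₀ ≤ (a : ℝ) - 1 := by
          have := Nat.lt_floor_add_one (Y / y₀)
          rw [← ha] at this
          rw [div_le_iff₀ hy₀]
          have h' : Y / y₀ * y₀ = Y := by field_simp
          nlinarith
        gcongr
    _ = 2 * M / (y₀ * (Y - 2 * y₀)) := by
        field_simp

end RudnickSarnak

end Literature.NumberTheory.LFunctions

end
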